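import Summits.BirchSwinnertonDyer.BirchSwinnertonDyer.Theorems.SignedLowerHalvesSmallImageLowerHalfBothSignsRttLayerLawDepleted
import Summits.BirchSwinnertonDyer.Rank1Residual.X1.LambdaSqueezeAlgebra
import Summits.BirchSwinnertonDyer.Rank1Residual.X2.AnalyticInvariants
import Literature.NumberTheory.EllipticCurves.Kobayashi2003.SignedSelmerTorsion
import Summits.BirchSwinnertonDyer.BirchSwinnertonDyer.Theorems.ResidualThetaTransportAtTwoResidualThetaMainConjectureAtTwoAnalyticLayerLawAtTwo
import Summits.BirchSwinnertonDyer.BirchSwinnertonDyer.Theorems.ResidualThetaTransportAtTwoThetaLayerLambdaCongruenceAtTwoCurveEulerHecke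
import Literature.NumberTheory.EllipticCurves.BDKim2009.SignedSelmerCongruentLambdaInvariant
import Literature.NumberTheory.EllipticCurves.PollackRubin2004.SignedMainTheoremCM
import Literature.NumberTheory.EllipticCurves.Kobayashi2003.SignedSelmerDualExistsProofs
import Literature.NumberTheory.EllipticCurves.PAdicLFunctionProofs
import HarnessLib

/-!
# Route `SignedLowerHalves`, crux L `SmallImageLowerHalfBothSigns` (item stmt-BirchSwinnertonDyer-23599), line `rtt_w3` v3:
# the engine stub ENG `stub_partnerLayerLambdaLower_ns` HOLDS FOR A CM-CURVE PARTNER (tier T1) — from print BY NAME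

LEAD `cruxlead-stmt-BirchSwinnertonDyer-23599` g0 (cell `bsd-ssimc`); ROUTE-INDEPENDENT helper (`--supports
stmt-BirchSwinnertonDyer-23599`); THEOREMS ONLY — no definition, no named fact, no `sorry`; closes nothing: the registered ENG quantifies
over EVERY level-matched CM newform partner, this file treats the RATIONAL ones (`g = f_A`, `A/ℚ` a CM elliptic curve with
`A[p] ≅ W[p]` — 79 of the 136 open census pairs, cdisprove's T1-CENSUS: 57 @ 3, 22 @ 5). BSD / crux L are NOT proved by this.

THE THEOREM (`partnerLayerLambdaLower_of_cmCurvePartner`). Let `W/ℚ` be good at the odd prime `p` with `a_p(W) = 0`, `A/ℚ` a CM curve,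
good supersingular at `p` with `a_p(A) = 0`, `W[p] ≃ A[p]` `Γ_ℚ`-equivariantly, `g = f_A` the newform of `A` (so `M = N_A`), `ι : K_g → ℚ̄_p`,
`Ω` a plus period of `g`, `ϖ_A·Ω_A = Ω⁺_{f_A}`, and suppose `f_A` has a Pollack pair at `p`. GRANTED BY NAME Kobayashi Thm 1.2 (`h12`),
B. D. Kim 2009 Cor 2.13 (λ) (`hKim`) and Pollack–Rubin 2004 (`hPR`): for every cyclotomic `(κ, γ)`, every finite `S₀ ∌ p` containing
bad(W) and the primes of `N_A`, and every signed dual datum `D` of `W` of sign `ε` (f.g., torsion, `μ = 0`),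
`λ_n(θ^{S₀}_n(g)^ι) ≤ deg ω_n^{−ε} + λ(X^ε_W) + Σ_{v∈S₀} δ_W^{(v)}` for all `n ≫ 0` of the parity of `ε` — ENG's body at this partner,
in fact with EQUALITY. Proof: the `g`-side depleted layer element is `C(c)·θ^{S₀}_n(f_A)` (`exists_C_mul_map_mazurTateElementK`: Shimura
period scaling for a rational newform; `partnerEulerFactor_eq`: its Euler factors ARE `A`'s local polynomials), so its layer-`λ` is
`λ(L^ε_A) + Σδ_A + deg ω_n^{−ε}` by the PROVED AN_W law for `A` (`SmallImageRttLayerLaw.eventually_layerLambda_depleted_of_isPollackPair`, p744056); `λ(L^ε_A) = λ(X^ε_A)` by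
Pollack–Rubin (char-ideal generator = `ϖ_A·L^ε_A` up to `ι`); `λ(X^ε_A) + Σδ_A = λ(X^ε_W) + Σδ_W` by Kim's λ-transfer.

References: [BDKim2009] Cor. 2.13, Prop. 2.6; [PollackRubin2004] Theorem (p. 448); [Kobayashi2003] Thm. 1.2; [Pollack2003] Prop. 6.18;
[GreenbergVatsal2000] §2 Prop. (2.4), Thm. (1.4); [PollackWeston2011MT] §2.2 Def. 2.1, §3.1.
-/

set_option autoImplicit false
-- D-0017: single-problem summit, the namespace repeats the problem name by design.
set_option linter.dupNamespace false
noncomputable section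

open scoped Classical MatrixGroups ModularForm BigOperators

open CongruenceSubgroup WeierstrassCurve Field Polynomial NumberField IsDedekindDomain
  Literature.NumberTheory.EllipticCurves Literature.NumberTheory.EllipticCurves.ModularForms
  Literature.NumberTheory.EllipticCurves.Rank1Residual
  Literature.NumberTheory.EllipticCurves.Kobayashi2003
  Literature.NumberTheory.EllipticCurves.GreenbergVatsal2000 ZpExtension
  Literature.NumberTheory.IwasawaTheory Rat.HeightOneSpectrum
  Summit.BirchSwinnertonDyer.Rank1Residual.Supersingular
  Summit.BirchSwinnertonDyer.Rank1Residual.X1.MuLambda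
  Summit.BirchSwinnertonDyer.Rank1Residual.X2.EulerFactorAlgebra
  Summit.BirchSwinnertonDyer.Rank1Residual.X2.EulerFactorInvariants

namespace Summit.BirchSwinnertonDyer.BirchSwinnertonDyer.Theorems.SmallImageRttOneSided

/-! ## §1 The Euler factors of a rational partner are the curve's local polynomials -/

section Euler

variable (A : WeierstrassCurve ℚ) [A.IsElliptic] [A.IsGloballyMinimal] {p : ℕ} [Fact p.Prime]

/-- **`L_v(A, X) = 1 − a_ℓ(A)·X + 𝟙_{ℓ∤N_A}·ℓ·X²` in `ℚ̄_p[X]`** for every finite place `v` of `ℚ` (`ℓ = ℓ_v`, `a_ℓ(A) = A.LFunction ℓ`):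
the reduction trichotomy (good / split or non-split multiplicative / additive). Port to `ℚ̄_p` of the tree's
`ThetaLayerLambdaCongruenceAtTwo.map_localPolynomialAt_eq` (stated there over `ℚ̄₂`). [cite: SilvermanAEC2009, §C.16 and Exercise 8.19(a)] -/
theorem map_localPolynomialAt_eq_padicAlgCl (v : HeightOneSpectrum (𝓞 ℚ)) :
    (A.localPolynomialAt v).map (Int.castRingHom (PadicAlgCl p)) =
      1 - C ((A.LFunction (natGenerator v) : PadicAlgCl p)) * X +
        (if natGenerator v ∣ A.conductorNorm ℤ then 0 else C (natGenerator v : PadicAlgCl p)) * X ^ 2 := by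
  haveI : Fact (natGenerator v).Prime := ⟨Rat.HeightOneSpectrum.prime_natGenerator v⟩
  rcases WeierstrassCurve.hasGoodReductionAt_or_hasMultiplicativeReductionAt_or_hasAdditiveReductionAt v A with
      hgood | hmul | hadd
  · have hndvd : ¬ natGenerator v ∣ A.conductorNorm ℤ :=
      fun h ↦ (WeierstrassCurve.dvd_conductorNorm_iff A v).mp h hgood
    have ha : A.LFunction (natGenerator v) = A.frobeniusTrace (natGenerator v) :=
      WeierstrassCurve.LFunction_apply_prime_eq_frobeniusTrace A _
        ((WeierstrassCurve.hasGoodReductionAtPrime_iff_hasGoodReductionAt_ringOfIntegers v A).mpr hgood)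
    rw [ThetaLayerLambdaCongruenceAtTwo.localPolynomialAt_eq_of_good hgood, if_neg hndvd, ha]
    simp only [Polynomial.map_add, Polynomial.map_sub, Polynomial.map_mul, Polynomial.map_pow, Polynomial.map_one,
      Polynomial.map_X, Polynomial.map_C]
    simp only [eq_intCast, Int.cast_natCast]
  · have hdvd : natGenerator v ∣ A.conductorNorm ℤ :=
      (WeierstrassCurve.dvd_conductorNorm_iff A v).mpr hmul.not_hasGoodReductionAt
    rw [if_pos hdvd, zero_mul, add_zero]
    by_cases hsplit : A.HasSplitMultiplicativeReductionAt v
    · rw [WeierstrassCurve.localPolynomialAt_of_hasSplitMultiplicativeReductionAt hsplit,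
        ← ThetaLayerLambdaCongruenceAtTwo.coe_primesEquiv_eq_natGenerator,
        A.LFunction_apply_primesEquiv_of_hasSplitMultiplicativeReductionAt hsplit]
      simp
    · rw [WeierstrassCurve.localPolynomialAt_of_hasMultiplicativeReductionAt_of_not_hasSplitMultiplicativeReductionAt
        hmul hsplit, ← ThetaLayerLambdaCongruenceAtTwo.coe_primesEquiv_eq_natGenerator,
        A.LFunction_apply_primesEquiv_of_hasMultiplicativeReductionAt_of_not_split hmul hsplit]
      simp
  · have hdvd : natGenerator v ∣ A.conductorNorm ℤ :=
      (WeierstrassCurve.dvd_conductorNorm_iff A v).mpr hadd.not_hasGoodReductionAt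
    rw [if_pos hdvd, zero_mul, add_zero, WeierstrassCurve.localPolynomialAt_of_hasAdditiveReductionAt hadd,
      ← ThetaLayerLambdaCongruenceAtTwo.coe_primesEquiv_eq_natGenerator,
      A.LFunction_apply_primesEquiv_of_hasAdditiveReductionAt hadd]
    simp

/-- **The partner's Euler factors at `g = f_A` ARE `A`'s local polynomials**: for the newform `g` of `A` (`IsNewformOf A g`:
`a_ℓ(g) = a_ℓ(A)` for all `ℓ`) and any `ι : K_g → ℚ̄_p`, `1 − ι(a_ℓ(g))·X + 𝟙_{ℓ∤N_A}·ℓ·X² = L_v(A, X)` in `ℚ̄_p[X]`.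
[cite: BreuilConradDiamondTaylor2001, Thm. A (a_ℓ(f_A) = a_ℓ(A))] [cite: SilvermanAEC2009, §C.16] -/
theorem partnerEulerFactor_eq {N : ℕ} [NeZero N] {g : CuspForm (Gamma0 N) 2} (hg : IsNewformOf A g)
    (ι : coeffField g →+* PadicAlgCl p) (v : HeightOneSpectrum (𝓞 ℚ)) :
    1 - C (embCoeff g ι (natGenerator v)) * X +
        (if natGenerator v ∣ A.conductorNorm ℤ then 0 else C (natGenerator v : PadicAlgCl p)) * X ^ 2 =
      (A.localPolynomialAt v).map (Int.castRingHom (PadicAlgCl p)) := by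
  rw [map_localPolynomialAt_eq_padicAlgCl, embCoeff_eq_intCast g ι (hg.2 (natGenerator v))]

end Euler

/-! ## §2 Shimura-period scaling for a rational newform: `θ_n(g)_Ω^ι = C(c)·θ_n(g)` -/

section Scaling

variable {N : ℕ} [NeZero N] {g : CuspForm (Gamma0 N) 2} {p : ℕ} [Fact p.Prime]

/-- **For a rational newform every Shimura plus period is a rational multiple of `Ω⁺_g` on the symbols**: there is `c ∈ K_g`, `c ≠ 0`,
with `[r]⁺_{g,Ω} = c·[r]⁺_{g,Ω⁺_g}` for all `r` (if some `plusSymbol g r₀ ≠ 0`, `c = Ω⁺_g/Ω`; otherwise both sides vanish and `c = 1`).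
[cite: PollackWeston2011MT, §2.2 and Def. 2.1 («well-defined up to scaling by elements α ∈ K_f»)] -/
theorem exists_plusSymbolK_eq_mul_plusPeriod (hg : IsNewform0 g) (hQ : coeffField g = ⊥) {Ω : ℂ} (hΩ : IsPlusPeriod g Ω) :
    ∃ c : coeffField g, c ≠ 0 ∧ ∀ r : ℚ, plusSymbolK g Ω r = c * plusSymbolK g (plusPeriod g : ℂ) r := by
  have hΩp : IsPlusPeriod g (plusPeriod g : ℂ) := isPlusPeriod_plusPeriod hg hQ
  have hΩ0 : Ω ≠ 0 := hΩ.1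
  have hΩp0 : (plusPeriod g : ℂ) ≠ 0 := hΩp.1
  -- every `[r]⁺_{g,Ω}` is rational: `plusSymbol g r / Ω = q_r`
  have hrat : ∀ r : ℚ, ∃ q : ℚ, (q : ℂ) = plusSymbol g r / Ω := fun r ↦ by
    have hmem : plusSymbol g r / Ω ∈ (⊥ : IntermediateField ℚ ℂ) := hQ ▸ hΩ.2 r
    obtain ⟨q, hq⟩ := IntermediateField.mem_bot.mp hmem
    exact ⟨q, by rw [← hq]; rfl⟩
  by_cases h : ∃ r₀ : ℚ, plusSymbol g r₀ ≠ 0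
  · obtain ⟨r₀, hr₀⟩ := h
    obtain ⟨q₀, hq₀⟩ := hrat r₀
    have hs₀ := ratCast_ratPlusSymbol_mul_plusPeriod g hg hQ r₀
    have hs₀0 : (ratPlusSymbol g r₀ : ℂ) ≠ 0 := by
      intro h0; rw [h0, zero_mul] at hs₀; exact hr₀ hs₀.symm
    set q : ℚ := q₀ / ratPlusSymbol g r₀ with hqdef
    have hq0 : q ≠ 0 := by
      have hq₀0 : (q₀ : ℂ) ≠ 0 := by rw [hq₀]; exact div_ne_zero hr₀ hΩ0
      refine div_ne_zero (by exact_mod_cast hq₀0) (by exact_mod_cast hs₀0)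
    refine ⟨algebraMap ℚ (coeffField g) q, by rw [Ne, map_eq_zero_iff _ (algebraMap ℚ (coeffField g)).injective]; exact hq0,
      fun r ↦ ?_⟩
    have hs := ratCast_ratPlusSymbol_mul_plusPeriod g hg hQ r
    apply Subtype.ext
    rw [MulMemClass.coe_mul, hΩ.coe_plusSymbolK, plusSymbolK_plusPeriod_eq_algebraMap hg hQ r]
    simp only [eq_ratCast]
    rw [hqdef]
    push_cast
    rw [hq₀]
    -- `plusSymbol r / Ω = (plusSymbol r₀/Ω) / [r₀]⁺ · [r]⁺` with `[r]⁺·Ω⁺ = plusSymbol r`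
    have e1 : (ratPlusSymbol g r : ℂ) = plusSymbol g r / (plusPeriod g : ℂ) := by
      rw [← hs, mul_div_cancel_right₀ _ hΩp0]
    have e0 : (ratPlusSymbol g r₀ : ℂ) = plusSymbol g r₀ / (plusPeriod g : ℂ) := by
      rw [← hs₀, mul_div_cancel_right₀ _ hΩp0]
    rw [e1, e0]
    field_simp
  · simp only [not_exists, not_not] at h
    refine ⟨1, one_ne_zero, fun r ↦ ?_⟩
    have h1 : plusSymbolK g Ω r = 0 := by
      apply Subtype.ext; rw [hΩ.coe_plusSymbolK, h r, zero_div, ZeroMemClass.coe_zero]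
    have h2 : plusSymbolK g (plusPeriod g : ℂ) r = 0 := by
      apply Subtype.ext; rw [hΩp.coe_plusSymbolK, h r, zero_div, ZeroMemClass.coe_zero]
    rw [h1, h2, mul_zero]

/-- **`θ_n(g)_Ω^ι = C(c)·θ_n(g)` in `ℚ̄_p[X]` for a rational newform** (`c ≠ 0` independent of `n`): the Mazur–Tate element relative to
any Shimura plus period `Ω`, read through `ι`, is a non-zero constant multiple of the tree's `mazurTateElement g p n`
(`map_mazurTateElementK_plusPeriod` at `Ω⁺_g` and the period scaling). [cite: PollackWeston2011MT, §2.1 (2.1), §2.2]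
[cite: Pollack2003, Def. 6.15] -/
theorem exists_C_mul_map_mazurTateElementK (hg : IsNewform0 g) (hQ : coeffField g = ⊥) {Ω : ℂ} (hΩ : IsPlusPeriod g Ω)
    (ι : coeffField g →+* PadicAlgCl p) :
    ∃ c : PadicAlgCl p, c ≠ 0 ∧ ∀ n : ℕ, (mazurTateElementK g Ω p n).map ι =
      C c * (mazurTateElement g p n).map (algebraMap ℚ (PadicAlgCl p)) := by
  classical
  obtain ⟨c, hc0, hc⟩ := exists_plusSymbolK_eq_mul_plusPeriod hg hQ hΩ
  refine ⟨ι c, (map_ne_zero ι).mpr hc0, fun n ↦ ?_⟩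
  haveI := neZero_torsionOrder p
  haveI := Fintype.ofFinite (rootsOfUnity (torsionOrder p) ℤ_[p])
  have hK : mazurTateElementK g Ω p n = C c * mazurTateElementK g (plusPeriod g : ℂ) p n := by
    rw [mazurTateElementK, mazurTateElementK, finsum_eq_sum_of_fintype, finsum_eq_sum_of_fintype, Finset.mul_sum]
    refine Finset.sum_congr rfl fun ξ _ ↦ ?_
    rw [Finset.mul_sum]
    refine Finset.sum_congr rfl fun s _ ↦ ?_
    rw [hc, Polynomial.C_mul, mul_assoc]
  rw [hK, Polynomial.map_mul, Polynomial.map_C, map_mazurTateElementK_plusPeriod ι hg hQ n]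

end Scaling

/-! ## §3 ENG for a CM-curve partner -/

section CMCurve

/-- **The engine stub ENG of line `rtt_w3` HOLDS AT A CM-CURVE PARTNER, from print by name.** See the module docstring: for `W`
good at the odd `p` with `a_p = 0`, a CM curve `A` good supersingular at `p` with `a_p(A) = 0` and `W[p] ≃ A[p]` (`Γ_ℚ`-equivariant),
its newform `g = f_A` with a Pollack pair, `ι`, a plus period `Ω`, `ϖ_A·Ω_A = Ω⁺_{f_A}`; granted Kobayashi Thm 1.2 (`h12`), Kim 2009
Cor 2.13-λ (`hKim`), Pollack–Rubin 2004 (`hPR`): for cyclotomic `(κ,γ)`, finite `S₀ ∌ p` ⊇ bad(W) ∪ primes(N_A), and a signed dual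
datum `D` of `W` of sign `ε` (f.g., torsion, `μ = 0`), for all `n ≫ 0` of the parity of `ε`:
`λ_n(θ^{S₀}_n(g)^ι) ≤ deg ω_n^{−ε} + λ(X^ε_W) + Σ_{v∈S₀} δ_W^{(v)}`. CONDITIONAL on the three named facts; closes nothing.
[cite: BDKim2009, Cor. 2.13] [cite: PollackRubin2004, Theorem (p. 448)] [cite: Kobayashi2003, Thm. 1.2] [cite: Pollack2003, Prop. 6.18] -/
theorem partnerLayerLambdaLower_of_cmCurvePartner
    (h12 : thm12_signedSelmerDual_finite_torsion)
    (hKim : BDKim2009.cor213_signedLambda_add_sum_delta_eq_of_torsionIso)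
    (hPR : PollackRubin2004.mainTheorem_signedCharIdeal_eq_of_cm)
    (W A : WeierstrassCurve ℚ) [W.IsElliptic] [W.IsGloballyMinimal] [A.IsElliptic] [A.IsGloballyMinimal]
    (p : ℕ) [Fact p.Prime] (hp2 : p ≠ 2)
    (hgoodW : W.HasGoodReductionAtPrime p) (hapW : W.frobeniusTrace p = 0)
    (hcmA : A.HasCM) (hssA : GoodSS A p) (hapA : A.frobeniusTrace p = 0)
    (he : ∃ e : geomTorsion W (p : ℤ) ≃+ geomTorsion A (p : ℤ),
      ∀ (σ : Field.absoluteGaloisGroup ℚ) (P : geomTorsion W (p : ℤ)), e (σ • P) = σ • e P)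
    [NeZero (A.conductorNorm ℤ)] (g : CuspForm (Gamma0 (A.conductorNorm ℤ)) 2) (hg : IsNewformOf A g)
    (ι : coeffField g →+* PadicAlgCl p) (Ω : ℂ) (hΩ : IsPlusPeriod g Ω)
    (ϖA : ℚ) (hϖA : (ϖA : ℝ) * A.realPeriodRat = plusPeriod g)
    (hPolA : ∃ Lp Lm : IwasawaAlgebra p, IsPollackPair g p Lp Lm)
    (ε : ℤˣ) (κ : ZpExtension ℚ p) (γ : absoluteGaloisGroup ℚ) (hκ : κ.IsCyclotomic) (hγ : κ.IsTopGenerator γ)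
    (hγ' : IsCyclotomicVariable p γ)
    (S₀ : Finset (HeightOneSpectrum (𝓞 ℚ))) (hS₀p : ∀ v ∈ S₀, ((p : ℕ) : 𝓞 ℚ) ∉ v.asIdeal)
    (hS₀W : ∀ v : HeightOneSpectrum (𝓞 ℚ), ¬ W.HasGoodReductionAt v → v ∈ S₀)
    (hS₀A : ∀ v : HeightOneSpectrum (𝓞 ℚ), natGenerator v ∣ A.conductorNorm ℤ → v ∈ S₀)
    (D : SignedSelmerDualData W κ γ ε) [Module.Finite (IwasawaAlgebra p) D.X]
    (hXt : Module.IsTorsion (IwasawaAlgebra p) D.X) (hμ : D.mu = 0) :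
    ∃ n₀ : ℕ, ∀ n ≥ n₀, (Even n ↔ ε = 1) →
      ((layerLambda (((mazurTateElementK g Ω p n).map ι *
              ∏ v ∈ S₀, (1 - C (embCoeff g ι (natGenerator v)) * X +
                  (if natGenerator v ∣ A.conductorNorm ℤ then 0 else C (natGenerator v : PadicAlgCl p)) * X ^ 2).comp
                (C ((natGenerator v : PadicAlgCl p)⁻¹) *
                  (X + 1) ^ (PadicInt.toZModPow n (-(frobeniusExponent p (natGenerator v : ℤ_[p])))).val)) %ₘ
              ((X + 1) ^ p ^ n - 1)) : ℕ) : ℤ) ≤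
        ((if ε = 1 then cyclotomicOmegaMinus p n else cyclotomicOmegaPlus p n).natDegree : ℤ) + ((lambdaInvariant p D.X : ℕ) : ℤ) + ((∑ v ∈ S₀, delta W p v : ℕ) : ℤ) := by
  obtain ⟨Lp, Lm, hPPA⟩ := hPolA
  have hgoodA : A.HasGoodReductionAtPrime p := hssA.1
  -- (1) AN_W for `A`
  have hS' : ∀ v ∈ S₀, natGenerator v ≠ p := fun v hv ↦ natGenerator_ne_of_natCast_not_mem v (hS₀p v hv)
  obtain ⟨n₁, hn₁⟩ :=
    Summit.BirchSwinnertonDyer.BirchSwinnertonDyer.Theorems.SmallImageRttLayerLaw.eventually_layerLambda_depleted_of_isPollackPair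
      A hp2 g hPPA ε S₀ hS'
  -- (2) Pollack–Rubin for `A`: `λ(X^ε_A) = λ(L^ε_A)`
  obtain ⟨DA⟩ := Kobayashi2003.nonempty_signedSelmerDualData (W := A) (κ := κ) (ε := ε) hγ
  haveI : Module.Finite (IwasawaAlgebra p) DA.X := h12.moduleFinite hp2 hgoodA hapA hκ hγ DA
  have hXtA : Module.IsTorsion (IwasawaAlgebra p) DA.X := h12.isTorsion hp2 hgoodA hapA hκ hγ DA
  obtain ⟨-, gA, hcharA, hιgA⟩ := hPR A p hcmA hp2 hssA ε κ γ hκ hγ hγ' g hg ϖA hϖA Lp Lm hPPA DA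
  set LA := kobayashiL ε Lp Lm with hLAdef
  have hιgA' : iwasawaToPowerSeries p gA = PowerSeries.C (ϖA : ℚ_[p]) * iwasawaToPowerSeries p LA := hιgA
  have hLA0 : LA ≠ 0 := by
    rcases Int.units_eq_one_or ε with rfl | rfl
    · simpa [hLAdef, kobayashiL] using hPPA.2.1
    · have : kobayashiL (-1) Lp Lm = Lp := by simp [kobayashiL]
      rw [hLAdef, this]; exact hPPA.1
  have hϖA0 : (ϖA : ℚ_[p]) ≠ 0 := by
    exact_mod_cast Summit.BirchSwinnertonDyer.Rank1Residual.X2.varpi_ne_zero_of_isNewformOf hg hϖA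
  obtain ⟨hgA0, hlamgA⟩ :=
    Summit.BirchSwinnertonDyer.BirchSwinnertonDyer.Theorems.ResidualThetaLayer.lam_eq_of_iwasawaToPowerSeries_eq_C_mul
      hϖA0 hLA0 hιgA'
  have hlamA := Summit.BirchSwinnertonDyer.Rank1Residual.X1.ParitySqueeze.lam_generator_eq_lambdaInvariant DA.X hXtA hgA0 hcharA
  rw [hlamgA] at hlamA
  -- (3) Kim's λ-transfer `W ↔ A`
  have hS₀A' : ∀ v : HeightOneSpectrum (𝓞 ℚ), ¬ A.HasGoodReductionAt v → v ∈ S₀ := fun v hv ↦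
    hS₀A v ((WeierstrassCurve.dvd_conductorNorm_iff A v).mpr hv)
  have hKimW := hKim W A p hp2 hgoodW hapW hgoodA hapA he κ γ hκ hγ S₀ hS₀p hS₀W hS₀A' ε D DA hXt hXtA hμ
  -- (4) the `g`-side layer element is `C(c)·` the `A`-side one
  obtain ⟨c, hc0, hθ⟩ := exists_C_mul_map_mazurTateElementK hg.1 hg.coeffField_eq_bot hΩ ι
  have hfac : ∀ v : HeightOneSpectrum (𝓞 ℚ), ∀ n : ℕ, (1 - C (embCoeff g ι (natGenerator v)) * X +
                  (if natGenerator v ∣ A.conductorNorm ℤ then 0 else C (natGenerator v : PadicAlgCl p)) * X ^ 2).comp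
                (C ((natGenerator v : PadicAlgCl p)⁻¹) *
                  (X + 1) ^ (PadicInt.toZModPow n (-(frobeniusExponent p (natGenerator v : ℤ_[p])))).val) = ((A.localPolynomialAt v).map (Int.castRingHom (PadicAlgCl p))).comp
                (C ((natGenerator v : PadicAlgCl p)⁻¹) *
                  (X + 1) ^ (PadicInt.toZModPow n (-(frobeniusExponent p (natGenerator v : ℤ_[p])))).val) := by
    intro v n
    rw [partnerEulerFactor_eq A hg ι v]
  refine ⟨n₁, fun n hn hpar ↦ ?_⟩
  have h1 := hn₁ n hn hpar
  have hrew : (((mazurTateElementK g Ω p n).map ι *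
              ∏ v ∈ S₀, (1 - C (embCoeff g ι (natGenerator v)) * X +
                  (if natGenerator v ∣ A.conductorNorm ℤ then 0 else C (natGenerator v : PadicAlgCl p)) * X ^ 2).comp
                (C ((natGenerator v : PadicAlgCl p)⁻¹) *
                  (X + 1) ^ (PadicInt.toZModPow n (-(frobeniusExponent p (natGenerator v : ℤ_[p])))).val)) %ₘ
              ((X + 1) ^ p ^ n - 1)) =
      C c * (((mazurTateElement g p n).map (algebraMap ℚ (PadicAlgCl p)) *
              ∏ v ∈ S₀, ((A.localPolynomialAt v).map (Int.castRingHom (PadicAlgCl p))).comp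
                (C ((natGenerator v : PadicAlgCl p)⁻¹) *
                  (X + 1) ^ (PadicInt.toZModPow n (-(frobeniusExponent p (natGenerator v : ℤ_[p])))).val)) %ₘ
              ((X + 1) ^ p ^ n - 1)) := by
    rw [hθ n, Finset.prod_congr rfl (fun v _ ↦ hfac v n), mul_assoc, C_mul', smul_modByMonic, ← C_mul']
  rw [hrew, Summit.BirchSwinnertonDyer.BirchSwinnertonDyer.Theorems.ResidualThetaLayer.layerLambda_C_mul hc0, h1, hlamA]
  have hK' : ((lambdaInvariant p D.X : ℕ) : ℤ) + ((∑ v ∈ S₀, delta W p v : ℕ) : ℤ) =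
      ((lambdaInvariant p DA.X : ℕ) : ℤ) + ((∑ v ∈ S₀, delta A p v : ℕ) : ℤ) := by
    exact_mod_cast hKimW
  push_cast [Nat.cast_add] at hK' ⊢
  omega

end CMCurve

end Summit.BirchSwinnertonDyer.BirchSwinnertonDyer.Theorems.SmallImageRttOneSided

end
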